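import Summits.ResolutionOfSingularities.ResolutionOfSingularities.Theorems.EquisingularLiftEquisingularLiftNatInCarrierStepFlatRing
import Summits.ResolutionOfSingularities.ResolutionOfSingularities.Theorems.EquisingularLiftEquisingularLiftNatSubchainSupplierInvDefs
import Literature.AlgebraicGeometry.Resolution.BlowupAlgebraQuasiRegularChart
import HarnessLib

/-!
# [OURS · L1 W4.5(b) · EL♮(3)] K8 (γ), ring half: `TCPlus.ConeDeltaRegular` REDUCES TO THE CARRIER — the quotient of the section
# blow-up chart `A[c/c_j]_𝔔` by the in-carrier centre `(e₀) + (Φ(e′))` is the carrier's own blow-up chart modulo the strict transform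
# `Φ̄(ē′)`, and the codimension-2 clause is automatic (crux `EquisingularLiftNatThree` stmt-ResolutionOfSingularities-20148 / parent 20038;
# rungs v7 TC⁺ (`stub_elnat_tcPlusPointResolution`, res-type-100 inv_base (β)) and v7′ TC⁺⁺ (`stub_elnat_tcPlusPlusPointResolution`, K8 (γ)))

NOT a statement of any manuscript. Helper file of the chain res-L1-w45b (cell `res-hironaka`, LADDER-RESOLUTION rung L, slot W4.5(b));
OURS; AI-written, weaker than expert review; `--supports stmt-ResolutionOfSingularities-20148 --as helper` by res-L1-w45b-stub-2 (object
K8 (γ) of res-L1-w45b-stub-3's TCPP-SUPPLIER-MAP, booked by res-L1-w45b-plan-1 2026-08-27T13:14:06Z; = offer (O-β) to res-type-100).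
No `sorry`; standard axioms. It closes nothing by itself.

WHAT. res-L1-w45b-stub-1's `TCPlus.ConeDeltaRegular c Φ` (…NatSubchainSupplierInvDefs, p532383) asks, for every chart `j = j′+1` of the
blow-up of the section ideal `(c)` of `A = 𝒪_{X,p}`, every prime `𝔔` of `B = A[c/c_j]` over `𝔪_A` containing `e₀ = c₀/c_j` and
`Φ(e′)` (`e′_l = c_{l+1}/c_j`), and every model `S` of `B_𝔔`: `S ⧸ ((e₀) + (Φ(e′)))` is a regular local ring and
`dim (S ⧸ ((e₀) + (Φ(e′)))) + 2 = dim S`. This file proves it from a hypothesis that lives ENTIRELY IN THE CARRIER `A₀ = A/(c₀)`: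

  (H-model)  for every `j′`, every prime `𝔮` of the carrier's own blow-up chart `B̄ = A₀[c̄′/c̄_j′]` lying over the closed
             point of `A` and containing the strict transform `Φ̄(ē′)` (`Φ̄ = Φ mod c₀`, `ē′ = c̄′/c̄_j′`), and every model
             `T` of `B̄_𝔮` (`IsLocalization.AtPrime T 𝔮`): the local ring `T ⧸ (Φ̄(ē′))` is regular.

(For the HSUB′ suppliers `A₀ = 𝒪_{E,p}` with `E ≅ ℙ²_O`, so `B̄` is a localised POLYNOMIAL blow-up chart and (H-model) is the
conclusion shape of res-L1-w45b-stub-1's T-ΔLIFT-CENTRED p523916 / res-L1-w45b-stub-3's part 9 p531761 for the strict-transform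
charts — the remaining, presentation-dependent step of K8 (γ) / inv_base (β), not done here.)

* `TCPlus.map_isPrime_carrier` — the prime `𝔮 = θ₀(𝔔)` of the carrier chart (`θ₀ : B = A[c/c_j] ↠ B̄`, `ker θ₀ = (e₀)`,
  res-L1-w45b-stub-1 …NatCarrierStrictTransformChart p521033);
* `TCPlus.isLocalization_atPrime_quotient_of_surjective`, `exists_lift_quotient_map_ker` (generic) — **localisation commutes with
  quotients**: for `θ : B ↠ C` and a model `S` of `B_𝔔` (`ker θ ⊆ 𝔔`), `S ⧸ (ker θ)S` is a model of `C_{θ(𝔔)}`;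
* **`TCPlus.isRegularLocalRing_quot_carrierSup_of_carrier`** — regularity of `S ⧸ ((e₀) + (Φ(e′)))` from (H-model) applied to the
  model `T = S ⧸ (e₀)S` of `B̄_{θ₀(𝔔)}`: `S ⧸ ((e₀) + (Φ(e′))) ≅ T ⧸ (Φ̄(ē′))`;
* `TCPlus.isDomain_blowupAlgebra_of_ne_zero`, `aeval_frac_carrier_ne_zero` (`Φ̄(ē′) ≠ 0`: `Φ̄(c̄′)/1 = (c̄_j/1)ᵐ·Φ̄(ē′)` in the
  domain `B̄ ⊇ A₀`), `algebraMap_aeval_notMem_span` (`Φ(e′)/1 ∉ (e₀)S`);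
* **`TCPlus.ringKrullDim_quot_carrierSup_add_two`** — the codimension clause, with NO carrier input: `e₀/1` and then `Φ(e′)/1`
  are non-zero elements of the maximal ideals of the Noetherian local domains `S` and `S ⧸ (e₀)S` (`(e₀)S` is prime: `ker θ₀` is
  prime and inside `𝔔`), so each quotient drops the dimension by exactly one (Mathlib
  `ringKrullDim_quotient_span_singleton_succ_eq_ringKrullDim_of_mem_nonZeroDivisors`);
* **`TCPlus.coneDeltaRegular_of_carrier`** — the package, and **`…_of_rsop`** with the side conditions (`c` quasi-regular, `A`,
  `A/(c)`, `A/(c₀)` domains, `c_j ∉ (c₀)`, `Φ(c′) ∉ (c₀)`) discharged from `(c) + (ϖ) = 𝔪`, `dim A = r + 2`, `Φ mod 𝔪 ≠ 0`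
  (res-L1-w45b-stub-2 …NatInCarrierStepFlatRing p530905).

References: The Stacks Project, Tag 080C; U. Görtz, T. Wedhorn, *Algebraic Geometry I* (2020), Prop. 13.96 (2); H. Matsumura,
*Commutative Ring Theory* (1986), Thm. 14.2, Thm. 17.4 [cite: Matsumura1987]. Tree inputs: p521033, p530905, p532383, …NatConeChart
(`algebraMap_eval_eq_pow_mul_coneTransform`), …NatEquimultipleStrictTransformFlat (`isDomain_blowupAlgebra_reduction`), Literature
BlowupAlgebraQuasiRegularChart (`isNoetherianRing_blowupAlgebra`).
-/

set_option linter.dupNamespace false -- mandated namespace `Summit.<Summit>.<Problem>` of this single-conjunct summit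

noncomputable section

namespace Summit.ResolutionOfSingularities.ResolutionOfSingularities.Cruxes.EquisingularLiftNat.Sections.TCPlus

open MvPolynomial IsLocalRing Literature.AlgebraicGeometry.Resolution
open Summit.ResolutionOfSingularities.ResolutionOfSingularities.Cruxes.EquisingularLiftNat.Sections

universe u

variable {A : Type u} [CommRing A] {r : ℕ} (c : Fin (r + 1) → A) (j' : Fin r) (Φ : MvPolynomial (Fin r) A)

/-! ## The prime of the carrier chart under `θ₀ : A[c/c_j] ↠ (A/c₀)[c̄′/c̄_j′]` -/

/-- The prime `𝔮 = θ₀(𝔔)` of the carrier chart is prime and pulls back to `𝔔` (since `ker θ₀ = (e₀) ⊆ 𝔔`). [folklore] -/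
theorem map_isPrime_carrier (hc : IsQuasiRegular c) [IsDomain (A ⧸ Ideal.span (Set.range c))]
    (𝔔 : Ideal (blowupAlgebra (Ideal.span (Set.range c)) (c j'.succ))) [𝔔.IsPrime] (he₀ : blowupAlgebra.frac c j'.succ 0 ∈ 𝔔) :
    (𝔔.map (blowupAlgebraMap (Ideal.Quotient.mk (Ideal.span {c 0})) (Ideal.span (Set.range c))
        (Ideal.span (Set.range fun l : Fin r => Ideal.Quotient.mk (Ideal.span {c 0}) (c l.succ))) (c j'.succ)
        (map_span_range_le_span_range_tail c))).IsPrime ∧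
      (𝔔.map (blowupAlgebraMap (Ideal.Quotient.mk (Ideal.span {c 0})) (Ideal.span (Set.range c))
        (Ideal.span (Set.range fun l : Fin r => Ideal.Quotient.mk (Ideal.span {c 0}) (c l.succ))) (c j'.succ)
        (map_span_range_le_span_range_tail c))).comap
        (blowupAlgebraMap (Ideal.Quotient.mk (Ideal.span {c 0})) (Ideal.span (Set.range c))
          (Ideal.span (Set.range fun l : Fin r => Ideal.Quotient.mk (Ideal.span {c 0}) (c l.succ))) (c j'.succ)
          (map_span_range_le_span_range_tail c)) = 𝔔 := by
  have hker : RingHom.ker (blowupAlgebraMap (Ideal.Quotient.mk (Ideal.span {c 0})) (Ideal.span (Set.range c))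
      (Ideal.span (Set.range fun l : Fin r => Ideal.Quotient.mk (Ideal.span {c 0}) (c l.succ))) (c j'.succ)
      (map_span_range_le_span_range_tail c)) ≤ 𝔔 := by
    rw [ker_blowupAlgebraMap_carrier c j' hc, Ideal.span_singleton_le_iff_mem]
    exact he₀
  exact ⟨Ideal.map_isPrime_of_surjective (blowupAlgebraMap_carrier_surjective c j') hker,
    by rw [Ideal.comap_map_of_surjective _ (blowupAlgebraMap_carrier_surjective c j'), ← RingHom.ker_eq_comap_bot,
      sup_eq_left.mpr hker]⟩

/-! ## Generic: the quotient of a localisation by the kernel of a surjection is a localisation of the target -/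

/-- **Localisation commutes with quotients (instance form).** `θ : B ↠ C` surjective, `S` a localisation of `B` at a prime
`𝔔 ⊇ ker θ`, `φ : C → S ⧸ (ker θ)·S` the induced map (`φ (θ b) = b/1 mod (ker θ)S`). Then `S ⧸ (ker θ)·S` is a localisation of
`C` at the prime `θ(𝔔)`, for the algebra structure `φ`. [folklore] -/
theorem isLocalization_atPrime_quotient_of_surjective {B C S : Type*} [CommRing B] [CommRing C] [CommRing S]
    (θ : B →+* C) (hθ : Function.Surjective θ) [Algebra B S] (𝔔 : Ideal B) [𝔔.IsPrime] [IsLocalization.AtPrime S 𝔔]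
    (hker : RingHom.ker θ ≤ 𝔔) [(𝔔.map θ).IsPrime]
    (φ : C →+* S ⧸ (RingHom.ker θ).map (algebraMap B S))
    (hφ : ∀ b, φ (θ b) = Ideal.Quotient.mk _ (algebraMap B S b)) :
    @IsLocalization.AtPrime C _ (S ⧸ (RingHom.ker θ).map (algebraMap B S)) _ φ.toAlgebra (𝔔.map θ) _ := by
  letI := φ.toAlgebra
  have hφalg : ∀ y, algebraMap C (S ⧸ (RingHom.ker θ).map (algebraMap B S)) y = φ y := fun _ => rfl
  have hcomap : (𝔔.map θ).comap θ = 𝔔 := by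
    rw [Ideal.comap_map_of_surjective _ hθ, ← RingHom.ker_eq_comap_bot, sup_eq_left.mpr hker]
  have hmem : ∀ b, θ b ∈ 𝔔.map θ ↔ b ∈ 𝔔 := fun b => by rw [← Ideal.mem_comap, hcomap]
  rw [IsLocalization.AtPrime, isLocalization_iff]
  refine ⟨?_, ?_, ?_⟩
  · rintro ⟨y, hy⟩
    obtain ⟨b, rfl⟩ := hθ y
    have hb : b ∈ 𝔔.primeCompl := fun h => hy ((hmem b).mpr h)
    rw [hφalg, hφ]
    exact (IsLocalization.map_units S (⟨b, hb⟩ : 𝔔.primeCompl)).map _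
  · intro z
    obtain ⟨s, rfl⟩ := Ideal.Quotient.mk_surjective z
    obtain ⟨⟨x, u⟩, hxu⟩ := IsLocalization.surj 𝔔.primeCompl s
    refine ⟨⟨θ x, ⟨θ u, fun h => u.2 ((hmem u).mp h)⟩⟩, ?_⟩
    simp only [hφalg, hφ]
    rw [← map_mul, hxu]
  · intro x y hxy
    obtain ⟨bx, rfl⟩ := hθ x
    obtain ⟨by_, rfl⟩ := hθ y
    rw [hφalg, hφalg, hφ, hφ, Ideal.Quotient.eq, ← map_sub, IsLocalization.algebraMap_mem_map_algebraMap_iff 𝔔.primeCompl] at hxy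
    obtain ⟨m, hm, hmx⟩ := hxy
    refine ⟨⟨θ m, fun h => hm ((hmem m).mp h)⟩, ?_⟩
    have h0 : θ (m * (bx - by_)) = 0 := (RingHom.mem_ker).mp hmx
    rw [map_mul, map_sub, mul_sub, sub_eq_zero] at h0
    exact h0

/-- The induced map `φ : C → S ⧸ (ker θ)·S` exists. [folklore] -/
theorem exists_lift_quotient_map_ker {B C S : Type*} [CommRing B] [CommRing C] [CommRing S] (θ : B →+* C)
    (hθ : Function.Surjective θ) [Algebra B S] :
    ∃ φ : C →+* S ⧸ (RingHom.ker θ).map (algebraMap B S), ∀ b, φ (θ b) = Ideal.Quotient.mk _ (algebraMap B S b) := by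
  have hle : RingHom.ker θ ≤ RingHom.ker ((Ideal.Quotient.mk ((RingHom.ker θ).map (algebraMap B S))).comp (algebraMap B S)) := by
    intro b hb
    rw [RingHom.mem_ker, RingHom.comp_apply, Ideal.Quotient.eq_zero_iff_mem]
    exact Ideal.mem_map_of_mem _ hb
  exact ⟨θ.liftOfSurjective hθ ⟨_, hle⟩, fun b => θ.liftOfSurjective_comp_apply hθ ⟨_, hle⟩ b⟩

/-! ## Regularity: reduction to the carrier chart -/

set_option maxHeartbeats 400000 in -- `blowupAlgebra` = subalgebra of a localisation: slow instance unification (cf. p522194, p530905)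
/-- **`S ⧸ ((e₀) + (Φ(e′)))` is regular as soon as the carrier chart modulo the strict transform is** — hypothesis (H-model): for the
prime `𝔮 = θ₀(𝔔)` of the carrier chart `B̄ = (A/c₀)[c̄′/c̄_j′]` and EVERY model `T` of `B̄_𝔮`, `T ⧸ (Φ̄(ē′))` is a regular local ring
(stated for all primes `𝔮` over `𝔔`; in the suppliers `B̄` is a localised polynomial chart and this is the conclusion shape of T-ΔLIFT-CENTRED
p523916 / part 9 p531761). [cite: GortzWedhorn2020, Prop. 13.96 (2) p. 416] [OURS · L1 W4.5b] K8 (γ); NOT a statement of the manuscript. -/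
theorem isRegularLocalRing_quot_carrierSup_of_carrier [IsLocalRing A] (hc : IsQuasiRegular c)
    [IsDomain (A ⧸ Ideal.span (Set.range c))]
    (hcar : ∀ (𝔮 : Ideal (blowupAlgebra (Ideal.span (Set.range fun l : Fin r => Ideal.Quotient.mk (Ideal.span {c 0}) (c l.succ)))
        ((fun l : Fin r => Ideal.Quotient.mk (Ideal.span {c 0}) (c l.succ)) j'))) [𝔮.IsPrime],
      𝔮.comap ((algebraMap (A ⧸ Ideal.span {c 0}) _).comp (Ideal.Quotient.mk (Ideal.span {c 0}))) = maximalIdeal A →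
      MvPolynomial.aeval (blowupAlgebra.frac (fun l : Fin r => Ideal.Quotient.mk (Ideal.span {c 0}) (c l.succ)) j')
          (MvPolynomial.map (Ideal.Quotient.mk (Ideal.span {c 0})) Φ) ∈ 𝔮 →
      ∀ (T : Type u) [CommRing T]
        [Algebra (blowupAlgebra (Ideal.span (Set.range fun l : Fin r => Ideal.Quotient.mk (Ideal.span {c 0}) (c l.succ)))
          ((fun l : Fin r => Ideal.Quotient.mk (Ideal.span {c 0}) (c l.succ)) j')) T] [IsLocalization.AtPrime T 𝔮],
        IsRegularLocalRing (T ⧸ Ideal.span {algebraMap _ T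
          (MvPolynomial.aeval (blowupAlgebra.frac (fun l : Fin r => Ideal.Quotient.mk (Ideal.span {c 0}) (c l.succ)) j')
            (MvPolynomial.map (Ideal.Quotient.mk (Ideal.span {c 0})) Φ))}))
    (𝔔 : Ideal (blowupAlgebra (Ideal.span (Set.range c)) (c j'.succ))) [𝔔.IsPrime]
    (h𝔔 : 𝔔.comap (algebraMap A _) = maximalIdeal A) (he₀ : blowupAlgebra.frac c j'.succ 0 ∈ 𝔔)
    (hΦ : MvPolynomial.aeval (fun l : Fin r => blowupAlgebra.frac c j'.succ l.succ) Φ ∈ 𝔔)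
    (S : Type u) [CommRing S] [Algebra (blowupAlgebra (Ideal.span (Set.range c)) (c j'.succ)) S]
    [IsLocalization.AtPrime S 𝔔] :
    IsRegularLocalRing (S ⧸ (Ideal.span {algebraMap _ S (blowupAlgebra.frac c j'.succ 0)} ⊔
      Ideal.span {algebraMap _ S (MvPolynomial.aeval (fun l : Fin r => blowupAlgebra.frac c j'.succ l.succ) Φ)})) := by
  classical
  set θ₀ := blowupAlgebraMap (Ideal.Quotient.mk (Ideal.span {c 0})) (Ideal.span (Set.range c))
    (Ideal.span (Set.range fun l : Fin r => Ideal.Quotient.mk (Ideal.span {c 0}) (c l.succ))) (c j'.succ)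
    (map_span_range_le_span_range_tail c) with hθ₀
  obtain ⟨h𝔮, h𝔮c⟩ := map_isPrime_carrier c j' hc 𝔔 he₀
  haveI := h𝔮
  have hkerθ : RingHom.ker θ₀ = Ideal.span {blowupAlgebra.frac c j'.succ 0} := ker_blowupAlgebraMap_carrier c j' hc
  have hkerle : RingHom.ker θ₀ ≤ 𝔔 := by rw [hkerθ, Ideal.span_singleton_le_iff_mem]; exact he₀
  -- the model `T := S ⧸ (e₀)S` of the carrier chart's local ring
  obtain ⟨φ, hφ⟩ := exists_lift_quotient_map_ker θ₀ (blowupAlgebraMap_carrier_surjective c j') (S := S)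
  have hloc := isLocalization_atPrime_quotient_of_surjective θ₀ (blowupAlgebraMap_carrier_surjective c j') 𝔔 hkerle φ hφ
  -- the prime `𝔮 = θ₀(𝔔)` lies over the closed point and contains `Φ̄(ē′) = θ₀(Φ(e′))`
  have hcomp : θ₀.comp (algebraMap A _) = (algebraMap (A ⧸ Ideal.span {c 0}) _).comp (Ideal.Quotient.mk (Ideal.span {c 0})) :=
    RingHom.ext fun a => by rw [RingHom.comp_apply, RingHom.comp_apply, hθ₀, blowupAlgebraMap_carrier_algebraMap]
  have hi : (𝔔.map θ₀).comap ((algebraMap (A ⧸ Ideal.span {c 0}) _).comp (Ideal.Quotient.mk (Ideal.span {c 0}))) =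
      maximalIdeal A := by
    rw [← hcomp, ← Ideal.comap_comap, h𝔮c, h𝔔]
  have hii : MvPolynomial.aeval (blowupAlgebra.frac (fun l : Fin r => Ideal.Quotient.mk (Ideal.span {c 0}) (c l.succ)) j')
      (MvPolynomial.map (Ideal.Quotient.mk (Ideal.span {c 0})) Φ) ∈ 𝔔.map θ₀ := by
    rw [← blowupAlgebraMap_carrier_aeval_tail c j' Φ, ← hθ₀]
    exact Ideal.mem_map_of_mem θ₀ hΦ
  have hreg := @hcar (𝔔.map θ₀) h𝔮 hi hii (S ⧸ (RingHom.ker θ₀).map (algebraMap _ S)) _ φ.toAlgebra hloc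
  -- `φ (Φ̄(ē′)) = Φ(e′)/1 mod (e₀)S`
  have hφg : @algebraMap _ (S ⧸ (RingHom.ker θ₀).map (algebraMap _ S)) _ _ φ.toAlgebra
      (MvPolynomial.aeval (blowupAlgebra.frac (fun l : Fin r => Ideal.Quotient.mk (Ideal.span {c 0}) (c l.succ)) j')
        (MvPolynomial.map (Ideal.Quotient.mk (Ideal.span {c 0})) Φ)) =
      Ideal.Quotient.mk _ (algebraMap _ S (MvPolynomial.aeval (fun l : Fin r => blowupAlgebra.frac c j'.succ l.succ) Φ)) := by
    rw [RingHom.algebraMap_toAlgebra, ← blowupAlgebraMap_carrier_aeval_tail c j' Φ, ← hθ₀, hφ]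
  rw [hφg] at hreg
  -- `(S ⧸ (e₀)S) ⧸ (Φ(e′)) ≅ S ⧸ ((e₀) + (Φ(e′)))`
  have hmapker : (RingHom.ker θ₀).map (algebraMap _ S) = Ideal.span {algebraMap _ S (blowupAlgebra.frac c j'.succ 0)} := by
    rw [hkerθ, Ideal.map_span, Set.image_singleton]
  have e : ((S ⧸ (RingHom.ker θ₀).map (algebraMap _ S)) ⧸ Ideal.span {Ideal.Quotient.mk _
      (algebraMap _ S (MvPolynomial.aeval (fun l : Fin r => blowupAlgebra.frac c j'.succ l.succ) Φ))}) ≃+*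
      S ⧸ (Ideal.span {algebraMap _ S (blowupAlgebra.frac c j'.succ 0)} ⊔
        Ideal.span {algebraMap _ S (MvPolynomial.aeval (fun l : Fin r => blowupAlgebra.frac c j'.succ l.succ) Φ)}) :=
    (Ideal.quotEquivOfEq (by rw [Ideal.map_span, Set.image_singleton])).trans
      ((DoubleQuot.quotQuotEquivQuotSup _ _).trans (Ideal.quotEquivOfEq (by rw [hmapker])))
  exact IsRegularLocalRing.of_ringEquiv e

/-! ## The codimension clause (no carrier input) -/

/-- The section chart `A[c/c_j]` of a domain is a domain (`c_j ≠ 0`). [folklore] -/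
theorem isDomain_blowupAlgebra_of_ne_zero [IsDomain A] (hcj : c j'.succ ≠ 0) :
    IsDomain (blowupAlgebra (Ideal.span (Set.range c)) (c j'.succ)) := by
  haveI : IsDomain (Localization.Away (c j'.succ)) :=
    IsLocalization.isDomain_localization (powers_le_nonZeroDivisors_of_noZeroDivisors hcj)
  exact Subalgebra.isDomain _

/-- **`Φ̄(ē′) ≠ 0` in the carrier chart** when `Φ` is a form with `Φ(c′) ∉ (c₀)` (`A/(c₀)` a domain, `c_j ∉ (c₀)`):
`Φ̄(c̄′)/1 = (c̄_j/1)ᵐ · Φ̄(ē′)` in the domain `B̄ ⊇ A/(c₀)`. [folklore] -/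
theorem aeval_frac_carrier_ne_zero [IsDomain (A ⧸ Ideal.span ({c 0} : Set A))]
    (hcj : c j'.succ ∉ Ideal.span ({c 0} : Set A)) {m : ℕ} (hΦd : Φ.IsHomogeneous m)
    (hΦ0 : MvPolynomial.eval (fun l => c l.succ) Φ ∉ Ideal.span ({c 0} : Set A)) :
    MvPolynomial.aeval (blowupAlgebra.frac (fun l : Fin r => Ideal.Quotient.mk (Ideal.span {c 0}) (c l.succ)) j')
      (MvPolynomial.map (Ideal.Quotient.mk (Ideal.span {c 0})) Φ) ≠ 0 := by
  intro h
  have hcone := algebraMap_eval_eq_pow_mul_coneTransform (fun l : Fin r => Ideal.Quotient.mk (Ideal.span {c 0}) (c l.succ)) j'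
    (hΦd.map (Ideal.Quotient.mk (Ideal.span {c 0})))
  have hev : MvPolynomial.eval (fun l : Fin r => Ideal.Quotient.mk (Ideal.span {c 0}) (c l.succ))
      (MvPolynomial.map (Ideal.Quotient.mk (Ideal.span {c 0})) Φ) =
      Ideal.Quotient.mk (Ideal.span {c 0}) (MvPolynomial.eval (fun l => c l.succ) Φ) := by
    rw [MvPolynomial.eval_map, show MvPolynomial.eval (fun l => c l.succ) Φ = MvPolynomial.eval₂ (RingHom.id _) (fun l => c l.succ) Φ
      from rfl, MvPolynomial.eval₂_comp_left, RingHom.comp_id]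
    rfl
  rw [h, mul_zero, hev] at hcone
  have hinj := algebraMap_blowupAlgebra_reduction_injective (fun l : Fin r => c l.succ) j' (c 0) hcj
  exact hΦ0 (Ideal.Quotient.eq_zero_iff_mem.mp (hinj (by rw [hcone, map_zero])))

/-- **`Φ(e′)/1 ∉ (e₀)·S`**: otherwise `m·Φ(e′) ∈ (e₀) = ker θ₀` for some `m ∉ 𝔔`, and in the DOMAIN `B̄` this forces `θ₀(m) = 0`
(impossible: `ker θ₀ ⊆ 𝔔`) or `Φ̄(ē′) = 0` (excluded by `aeval_frac_carrier_ne_zero`). [folklore] -/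
theorem algebraMap_aeval_notMem_span (hc : IsQuasiRegular c) [IsDomain (A ⧸ Ideal.span (Set.range c))]
    [IsDomain (A ⧸ Ideal.span ({c 0} : Set A))] (hcj : c j'.succ ∉ Ideal.span ({c 0} : Set A)) {m : ℕ}
    (hΦd : Φ.IsHomogeneous m) (hΦ0 : MvPolynomial.eval (fun l => c l.succ) Φ ∉ Ideal.span ({c 0} : Set A))
    (𝔔 : Ideal (blowupAlgebra (Ideal.span (Set.range c)) (c j'.succ))) [𝔔.IsPrime] (he₀ : blowupAlgebra.frac c j'.succ 0 ∈ 𝔔)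
    (S : Type*) [CommRing S] [Algebra (blowupAlgebra (Ideal.span (Set.range c)) (c j'.succ)) S] [IsLocalization.AtPrime S 𝔔] :
    algebraMap _ S (MvPolynomial.aeval (fun l : Fin r => blowupAlgebra.frac c j'.succ l.succ) Φ) ∉
      Ideal.span {algebraMap _ S (blowupAlgebra.frac c j'.succ 0)} := by
  haveI := isDomain_blowupAlgebra_reduction (fun l : Fin r => c l.succ) j' (c 0) hcj
  have hkerθ := ker_blowupAlgebraMap_carrier c j' hc
  rw [← Set.image_singleton, ← Ideal.map_span, IsLocalization.algebraMap_mem_map_algebraMap_iff 𝔔.primeCompl S]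
  rintro ⟨b, hb, hbG⟩
  rw [← hkerθ, RingHom.mem_ker, map_mul, blowupAlgebraMap_carrier_aeval_tail] at hbG
  rcases mul_eq_zero.mp hbG with h | h
  · refine hb ?_
    have hb' : b ∈ Ideal.span {blowupAlgebra.frac c j'.succ 0} := by rw [← hkerθ]; exact h
    exact (Ideal.span_singleton_le_iff_mem _).mpr he₀ hb'
  · exact aeval_frac_carrier_ne_zero c j' Φ hcj hΦd hΦ0 h

/-- **The codimension clause of `ConeDeltaRegular`, with no carrier input**: `dim (S ⧸ ((e₀) + (Φ(e′)))) + 2 = dim S` —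
`e₀/1` is a non-zero element of the maximal ideal of the Noetherian local domain `S` (`B ⊆ A[1/c_j]` is a domain), and
`Φ(e′)/1` is a non-zero element of the maximal ideal of the local domain `S ⧸ (e₀)S` (`(e₀)S` is prime: `(e₀) = ker θ₀` is prime
and inside `𝔔`); each drops the dimension by one. [cite: Matsumura1987, Thm. 17.4; StacksProject, Tag 00KW] -/
theorem ringKrullDim_quot_carrierSup_add_two [IsNoetherianRing A] [IsDomain A] (hc : IsQuasiRegular c)
    [IsDomain (A ⧸ Ideal.span (Set.range c))] [IsDomain (A ⧸ Ideal.span ({c 0} : Set A))]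
    (hcj : c j'.succ ∉ Ideal.span ({c 0} : Set A)) {m : ℕ} (hΦd : Φ.IsHomogeneous m)
    (hΦ0 : MvPolynomial.eval (fun l => c l.succ) Φ ∉ Ideal.span ({c 0} : Set A))
    (𝔔 : Ideal (blowupAlgebra (Ideal.span (Set.range c)) (c j'.succ))) [𝔔.IsPrime] (he₀ : blowupAlgebra.frac c j'.succ 0 ∈ 𝔔)
    (hΦ : MvPolynomial.aeval (fun l : Fin r => blowupAlgebra.frac c j'.succ l.succ) Φ ∈ 𝔔)
    (S : Type u) [CommRing S] [Algebra (blowupAlgebra (Ideal.span (Set.range c)) (c j'.succ)) S]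
    [IsLocalization.AtPrime S 𝔔] :
    ringKrullDim (S ⧸ (Ideal.span {algebraMap _ S (blowupAlgebra.frac c j'.succ 0)} ⊔
      Ideal.span {algebraMap _ S (MvPolynomial.aeval (fun l : Fin r => blowupAlgebra.frac c j'.succ l.succ) Φ)})) + 2 =
      ringKrullDim S := by
  classical
  have hcj0 : c j'.succ ≠ 0 := fun h => hcj (by rw [h]; exact Ideal.zero_mem _)
  haveI := isDomain_blowupAlgebra_of_ne_zero c j' hcj0
  haveI := isDomain_blowupAlgebra_reduction (fun l : Fin r => c l.succ) j' (c 0) hcj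
  haveI : IsLocalRing S := IsLocalization.AtPrime.isLocalRing S 𝔔
  haveI : IsNoetherianRing S := IsLocalization.isNoetherianRing 𝔔.primeCompl S (isNoetherianRing_blowupAlgebra _ _)
  haveI : IsDomain S := IsLocalization.isDomain_of_le_nonZeroDivisors S (Ideal.primeCompl_le_nonZeroDivisors 𝔔)
  have hinj : Function.Injective (algebraMap (blowupAlgebra (Ideal.span (Set.range c)) (c j'.succ)) S) :=
    IsLocalization.injective S (Ideal.primeCompl_le_nonZeroDivisors 𝔔)
  -- first drop: `e₀/1`
  have he₀0 : blowupAlgebra.frac c j'.succ 0 ≠ 0 := fun h => not_dvd_frac_zero c j' hc (by rw [h]; exact dvd_zero _)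
  have he₀'0 : algebraMap _ S (blowupAlgebra.frac c j'.succ 0) ≠ 0 := fun h => he₀0 (hinj (by rw [h, map_zero]))
  have he₀'𝔪 : algebraMap _ S (blowupAlgebra.frac c j'.succ 0) ∈ maximalIdeal S :=
    (IsLocalization.AtPrime.to_map_mem_maximal_iff S 𝔔 _).mpr he₀
  have h1 := ringKrullDim_quotient_span_singleton_succ_eq_ringKrullDim_of_mem_nonZeroDivisors
    (mem_nonZeroDivisors_of_ne_zero he₀'0) he₀'𝔪
  -- `S ⧸ (e₀)S` is a Noetherian local domain
  have hkerθ := ker_blowupAlgebraMap_carrier c j' hc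
  have hprime : (Ideal.span {blowupAlgebra.frac c j'.succ 0}).IsPrime := by
    rw [← hkerθ]; exact RingHom.ker_isPrime _
  have hdisj : Disjoint (𝔔.primeCompl : Set (blowupAlgebra (Ideal.span (Set.range c)) (c j'.succ)))
      (Ideal.span {blowupAlgebra.frac c j'.succ 0} : Ideal _) :=
    Set.disjoint_left.mpr fun b hb hbI => hb ((Ideal.span_singleton_le_iff_mem _).mpr he₀ hbI)
  haveI hP : (Ideal.span {algebraMap _ S (blowupAlgebra.frac c j'.succ 0)}).IsPrime := by
    rw [← Set.image_singleton, ← Ideal.map_span]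
    exact IsLocalization.isPrime_of_isPrime_disjoint 𝔔.primeCompl S _ hprime hdisj
  haveI : IsDomain (S ⧸ Ideal.span {algebraMap _ S (blowupAlgebra.frac c j'.succ 0)}) :=
    (Ideal.Quotient.isDomain_iff_prime _).mpr hP
  haveI : IsLocalRing (S ⧸ Ideal.span {algebraMap _ S (blowupAlgebra.frac c j'.succ 0)}) :=
    IsLocalRing.of_surjective' (Ideal.Quotient.mk _) Ideal.Quotient.mk_surjective
  -- second drop: `Φ(e′)/1 mod (e₀)S`
  have hG := algebraMap_aeval_notMem_span c j' Φ hc hcj hΦd hΦ0 𝔔 he₀ S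
  have hG0 : Ideal.Quotient.mk (Ideal.span {algebraMap _ S (blowupAlgebra.frac c j'.succ 0)})
      (algebraMap _ S (MvPolynomial.aeval (fun l : Fin r => blowupAlgebra.frac c j'.succ l.succ) Φ)) ≠ 0 :=
    fun h => hG (Ideal.Quotient.eq_zero_iff_mem.mp h)
  have hG𝔪 : Ideal.Quotient.mk (Ideal.span {algebraMap _ S (blowupAlgebra.frac c j'.succ 0)})
      (algebraMap _ S (MvPolynomial.aeval (fun l : Fin r => blowupAlgebra.frac c j'.succ l.succ) Φ)) ∈
      maximalIdeal (S ⧸ Ideal.span {algebraMap _ S (blowupAlgebra.frac c j'.succ 0)}) := by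
    rw [← IsLocalRing.map_maximalIdeal_of_surjective (Ideal.Quotient.mk _) Ideal.Quotient.mk_surjective]
    exact Ideal.mem_map_of_mem _ ((IsLocalization.AtPrime.to_map_mem_maximal_iff S 𝔔 _).mpr hΦ)
  have h2 := ringKrullDim_quotient_span_singleton_succ_eq_ringKrullDim_of_mem_nonZeroDivisors
    (mem_nonZeroDivisors_of_ne_zero hG0) hG𝔪
  have e : ((S ⧸ Ideal.span {algebraMap _ S (blowupAlgebra.frac c j'.succ 0)}) ⧸ Ideal.span {Ideal.Quotient.mk _
      (algebraMap _ S (MvPolynomial.aeval (fun l : Fin r => blowupAlgebra.frac c j'.succ l.succ) Φ))}) ≃+*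
      S ⧸ (Ideal.span {algebraMap _ S (blowupAlgebra.frac c j'.succ 0)} ⊔
        Ideal.span {algebraMap _ S (MvPolynomial.aeval (fun l : Fin r => blowupAlgebra.frac c j'.succ l.succ) Φ)}) :=
    (Ideal.quotEquivOfEq (by rw [Ideal.map_span, Set.image_singleton])).trans (DoubleQuot.quotQuotEquivQuotSup _ _)
  rw [← ringKrullDim_eq_of_ringEquiv e, ← h1, ← h2, ← one_add_one_eq_two, add_assoc]

/-! ## The package -/

/-- **K8 (γ), ring half: `ConeDeltaRegular c Φ` reduces to the carrier.** For a local domain `A`, `c` quasi-regular with `A/(c)`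
and `A/(c₀)` domains, `c_j ∉ (c₀)` (`j ≠ 0`), and a form `Φ` with `Φ(c′) ∉ (c₀)`: if (H-model) for every chart `j′` and every
prime `𝔮` of the carrier chart `B̄ = (A/c₀)[c̄′/c̄_j′]` over the closed point containing the strict transform `Φ̄(ē′)`, and every
model `T` of `B̄_𝔮`, the ring `T ⧸ (Φ̄(ē′))` is a regular local ring — then `TCPlus.ConeDeltaRegular c Φ`.
[cite: GortzWedhorn2020, Prop. 13.96 (2) p. 416] [OURS · L1 W4.5b] K8 (γ) = offer (O-β); NOT a statement of the manuscript. -/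
theorem coneDeltaRegular_of_carrier [IsLocalRing A] [IsNoetherianRing A] [IsDomain A] (hc : IsQuasiRegular c)
    [IsDomain (A ⧸ Ideal.span (Set.range c))] [IsDomain (A ⧸ Ideal.span ({c 0} : Set A))]
    (hcj : ∀ j' : Fin r, c j'.succ ∉ Ideal.span ({c 0} : Set A)) {m : ℕ} (hΦd : Φ.IsHomogeneous m)
    (hΦ0 : MvPolynomial.eval (fun l => c l.succ) Φ ∉ Ideal.span ({c 0} : Set A))
    (hcar : ∀ (j' : Fin r)
      (𝔮 : Ideal (blowupAlgebra (Ideal.span (Set.range fun l : Fin r => Ideal.Quotient.mk (Ideal.span {c 0}) (c l.succ)))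
        ((fun l : Fin r => Ideal.Quotient.mk (Ideal.span {c 0}) (c l.succ)) j'))) [𝔮.IsPrime],
      𝔮.comap ((algebraMap (A ⧸ Ideal.span {c 0}) _).comp (Ideal.Quotient.mk (Ideal.span {c 0}))) = maximalIdeal A →
      MvPolynomial.aeval (blowupAlgebra.frac (fun l : Fin r => Ideal.Quotient.mk (Ideal.span {c 0}) (c l.succ)) j')
          (MvPolynomial.map (Ideal.Quotient.mk (Ideal.span {c 0})) Φ) ∈ 𝔮 →
      ∀ (T : Type u) [CommRing T]
        [Algebra (blowupAlgebra (Ideal.span (Set.range fun l : Fin r => Ideal.Quotient.mk (Ideal.span {c 0}) (c l.succ)))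
          ((fun l : Fin r => Ideal.Quotient.mk (Ideal.span {c 0}) (c l.succ)) j')) T] [IsLocalization.AtPrime T 𝔮],
        IsRegularLocalRing (T ⧸ Ideal.span {algebraMap _ T
          (MvPolynomial.aeval (blowupAlgebra.frac (fun l : Fin r => Ideal.Quotient.mk (Ideal.span {c 0}) (c l.succ)) j')
            (MvPolynomial.map (Ideal.Quotient.mk (Ideal.span {c 0})) Φ))})) :
    ConeDeltaRegular c Φ := by
  intro j' 𝔔 _ h𝔔 he₀ hΦ S _ _ _
  exact ⟨isRegularLocalRing_quot_carrierSup_of_carrier c j' Φ hc (hcar j') 𝔔 h𝔔 he₀ hΦ S,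
    ringKrullDim_quot_carrierSup_add_two c j' Φ hc (hcj j') hΦd hΦ0 𝔔 he₀ hΦ S⟩

/-- **K8 (γ), ring half, side conditions discharged** from the RSOP hypotheses of the chain: `(c) + (ϖ) = 𝔪_A`,
`dim A = r + 2`, `Φ` a form with `Φ mod 𝔪 ≠ 0` (…NatInCarrierStepFlatRing: `A`, `A/(c)`, `A/(c₀)` are regular hence domains,
`c_j ∉ (c₀, ϖ)`, `Φ(c′) ∉ (c₀, ϖ)`). [cite: Matsumura1987, Thm. 14.2] [OURS · L1 W4.5b] -/
theorem coneDeltaRegular_of_carrier_of_rsop [IsLocalRing A] [IsNoetherianRing A] (ϖ : A)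
    (h𝔪 : Ideal.span (Set.range c) ⊔ Ideal.span {ϖ} = maximalIdeal A) (hdim : ringKrullDim A = (r + 2 : ℕ))
    {m : ℕ} (hΦd : Φ.IsHomogeneous m) (hΦ𝔪 : MvPolynomial.map (IsLocalRing.residue A) Φ ≠ 0)
    (hcar : ∀ (j' : Fin r)
      (𝔮 : Ideal (blowupAlgebra (Ideal.span (Set.range fun l : Fin r => Ideal.Quotient.mk (Ideal.span {c 0}) (c l.succ)))
        ((fun l : Fin r => Ideal.Quotient.mk (Ideal.span {c 0}) (c l.succ)) j'))) [𝔮.IsPrime],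
      𝔮.comap ((algebraMap (A ⧸ Ideal.span {c 0}) _).comp (Ideal.Quotient.mk (Ideal.span {c 0}))) = maximalIdeal A →
      MvPolynomial.aeval (blowupAlgebra.frac (fun l : Fin r => Ideal.Quotient.mk (Ideal.span {c 0}) (c l.succ)) j')
          (MvPolynomial.map (Ideal.Quotient.mk (Ideal.span {c 0})) Φ) ∈ 𝔮 →
      ∀ (T : Type u) [CommRing T]
        [Algebra (blowupAlgebra (Ideal.span (Set.range fun l : Fin r => Ideal.Quotient.mk (Ideal.span {c 0}) (c l.succ)))
          ((fun l : Fin r => Ideal.Quotient.mk (Ideal.span {c 0}) (c l.succ)) j')) T] [IsLocalization.AtPrime T 𝔮],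
        IsRegularLocalRing (T ⧸ Ideal.span {algebraMap _ T
          (MvPolynomial.aeval (blowupAlgebra.frac (fun l : Fin r => Ideal.Quotient.mk (Ideal.span {c 0}) (c l.succ)) j')
            (MvPolynomial.map (Ideal.Quotient.mk (Ideal.span {c 0})) Φ))})) :
    ConeDeltaRegular c Φ := by
  have hrsop := isRsopPart_of_sup_span_singleton_eq c ϖ h𝔪 hdim
  haveI := hrsop.isRegularLocalRing
  haveI : IsDomain A := isDomain_of_isRegularLocalRing A
  haveI := isDomain_quotient_of_sup_span_singleton_eq c ϖ h𝔪 hdim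
  haveI := (isDomain_quot_carrier_of_sup_span_singleton_eq c ϖ h𝔪 hdim).1
  have hnot := notMem_of_sup_span_singleton_eq c ϖ h𝔪 hdim
  exact coneDeltaRegular_of_carrier c Φ hrsop.isQuasiRegular
    (fun j' h => hnot.2.2 j'.succ (Fin.succ_ne_zero _) (Ideal.mem_sup_left h)) hΦd
    (fun h => eval_tail_notMem_of_sup_span_singleton_eq c ϖ h𝔪 hdim hΦd hΦ𝔪 (Ideal.mem_sup_left h)) hcar

end Summit.ResolutionOfSingularities.ResolutionOfSingularities.Cruxes.EquisingularLiftNat.Sections.TCPlus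

end
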